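import Summits.ABC.Harvest.OpenQuestions
import Summits.ABC.Analytic.Requirements
import Literature.NumberTheory.EllipticCurves.CongruenceNumberLevelBoundProofs
import Literature.NumberTheory.EllipticCurves.CuspFormLFunctionLevelConductorProofs
import Literature.NumberTheory.EllipticCurves.ModularParametrizationBCDTProofs
import HarnessLib

/-!
# ABC harvest 2015–2026: bridges to the abc-an cell's requirements table (glue, part 4)

`Summits/ABC/Harvest/OpenQuestionsGlueBridges.lean` — cell `abc-harv` (written by seat typ-1, draft be846385; landed by seat
pr-1 under KEY GLUE-MODULAR extended to §GLUE LEDGER G-24, director-abc 2026-08-27T16:53:57Z, with the import of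
`OpenQuestionsGlueDegree` replaced by its own imports while that module's farm olean was pending), namespace
`Summit.ABC.Harvest`.
By the cell lead's ruling (abc-harv-plan 2026-08-27T16:20:46Z: «cite, do not re-prove») the harvest Props are
bridged BY NAME to the abc-an cell's LANDED `Summits/ABC/Analytic/Requirements.lean` (p546687,
ns `Summit.ABC.Analytic`), so that each glue arrow exists once in the tree and the two idioms are interchangeable:

* `heightConjecture_iff_exists_polyFaltingsHeightRat` — our `HeightConjecture` (`∃ K C, ∀ E, h_F ≤ K log N + C`,
  Murty–Pasten Conj. 1.3 / Pasten Conj. 3.1) is LITERALLY `∃ K, Summit.ABC.Analytic.PolyFaltingsHeightRat K`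
  (`Iff.rfl`); hence «Height ⟹ A-PS» is also abc-an's `polySzpiroRat_of_polyFaltingsHeight` (same content as
  part 1's `exists_log_minimalDiscriminant_le_of_heightConjecture` / part 3's `polySzpiroRat_of_heightConjecture`).
* `exists_polyModularDegreeRat_of_modularDegreeConjecture` — the IDIOM BRIDGE from our `ModularDegreeConjecture`
  (Murty–Pasten's class-minimal `m_f` at conductor level, any model) to abc-an's `∃ K, PolyModularDegreeRat K`
  (SOME datum of degree `≤ C·N^K` on every globally minimal model), PROVED MODULO the two named facts of part 2
  (modularity `nonempty_modularParametrizationData`, Mazur–Kenku `PastenShimura2024_minimalDegree_le_163_mul`);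
  through it part 2's `heightConjecture_of_modularDegreeConjecture` (landed, `OpenQuestionsGlueDegree.lean`) is ALSO
  abc-an's `polyFaltingsHeightRat_of_polyModularDegreeRat` (exponent `K/2`) followed by the first bridge — not
  restated here (the gate's dedup: one declaration per arrow).
* `modularDegreeConjecture_of_exists_polyModularDegreeRat` — the CONVERSE idiom bridge, PROVED WITH NO NAMED FACT
  (seat pr-1): abc-an's datum on a global minimal model, transported along the level equality `N_{C•W} = N_W`
  (`exists_modularParametrizationData_of_level_eq`, `subst` on the `ℕ`-index), has the class's newform
  (`IsNewformOf.of_smul`, `IsNewformOf.unique`), so the class-minimal degree is at most `C · N^K`; hence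
  `modularDegreeConjecture_iff_exists_polyModularDegreeRat (hmod) (h163)`: **the two cells' typings of Pasten's
  Conj. 3.2 are EQUIVALENT modulo modularity + Mazur–Kenku** (director-abc «one Prop, not three»).

HONESTY LINE: abc is not proved by any of this; A-PS is NOT abc — «NOT abc — POLY-SZPIRO(E)»; PROVED-MOD-FACTS ≠
proved; typed ≠ proved. No `sorry`, no axiom, no new definition.
-/

noncomputable section

namespace Summit.ABC.Harvest

open Literature.NumberTheory.EllipticCurves
open Literature.NumberTheory.DiophantineGeometry

/-- **Bridge (PROVED, `Iff.rfl`): `HeightConjecture ↔ ∃ K, Summit.ABC.Analytic.PolyFaltingsHeightRat K`**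
(abc-an `Requirements.lean` R5: `PolyFaltingsHeightRat K := ∃ C, ∀ E/ℚ, h_F ≤ K log N + C`).
[cite: PastenShimura2024, Conj. 3.1 (§3, p. 13)] -/
theorem heightConjecture_iff_exists_polyFaltingsHeightRat :
    HeightConjecture ↔ ∃ K : ℝ, Summit.ABC.Analytic.PolyFaltingsHeightRat K :=
  Iff.rfl

section ModularDegree

open WeierstrassCurve
open Literature.NumberTheory.EllipticCurves.ModularForms
open Literature.NumberTheory.EllipticCurves.Pasten2024
open ModularForm CongruenceSubgroup
open scoped MatrixGroups

/-- **IDIOM BRIDGE (PROVED MODULO TWO NAMED FACTS): our `ModularDegreeConjecture` ⟹ abc-an's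
`∃ K, PolyModularDegreeRat K`.** Given `log m_f ≤ K log N + C` for class-minimal data at conductor level
(Murty–Pasten's idiom), every globally minimal elliptic `W/ℚ` carries a datum `D` at level `N_W` with
`deg D ≤ 163 e^{C+1} · N_W^K`: take a datum of minimal degree for `W` (modularity, `hmod`), bound it by
`163 ×` the class-minimal degree (Mazur–Kenku `h163`, `log_minModularDegree_le_of_class_bound`), and feed the
conjecture at the class-minimal datum `D₀` of its curve `W₀` — whose level `N_W` IS `N_{W₀}` by strong
multiplicity one across levels applied to a (modular) minimal model of `W₀`. [cite: PastenShimura2024, §3 p. 13 (Mazur–Kenku, δ_{1,N})]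
[cite: AtkinLehner1970, Thm. 4] -/
theorem exists_polyModularDegreeRat_of_modularDegreeConjecture
    (hmod : nonempty_modularParametrizationData)
    (h163 : PastenShimura2024_minimalDegree_le_163_mul)
    (h : ModularDegreeConjecture) : ∃ K : ℝ, Summit.ABC.Analytic.PolyModularDegreeRat K := by
  obtain ⟨K, C₀, hKC⟩ := h
  refine ⟨K, Real.exp (Real.log 163 + (C₀ + 1)), fun W _ _ _ => ?_⟩
  set N : ℕ := W.conductorNorm ℤ with hNdef
  have hN0 : (0 : ℝ) < (N : ℝ) := by exact_mod_cast conductorNorm_pos_holds W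
  -- a datum of minimal degree for `W`, and the class bound fed by the conjecture
  obtain ⟨D, hDmin⟩ := exists_modularDegree_eq_minModularDegree (hmod W)
  have hclass := log_minModularDegree_le_of_class_bound h163 (hmod W)
    (B := K * Real.log N + C₀ + 1)
    (fun W₀ _ D₀ hmin => by
      -- the level `N` is the conductor of `W₀`: modularity of a minimal model of `W₀` and strong
      -- multiplicity one across levels
      haveI : NeZero (W₀.conductorNorm ℤ) := ⟨(conductorNorm_pos_holds W₀).ne'⟩
      obtain ⟨C₀', hC₀'⟩ := hasGlobalMinimalModel_rat_holds W₀
      haveI := hC₀'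
      haveI : NeZero ((C₀' • W₀).conductorNorm ℤ) := ⟨(conductorNorm_pos_holds (C₀' • W₀)).ne'⟩
      obtain ⟨D'⟩ := hmod (C₀' • W₀)
      have hW₀ : ∃ g : CuspForm (Gamma0 (W₀.conductorNorm ℤ)) 2, IsNewformOf W₀ g :=
        exists_isNewformOf_of_level_eq (conductorNorm_smul_rat W₀ C₀')
          ⟨D'.f, IsNewformOf.of_smul C₀' D'.isNewformOf⟩
      have hlev : N = W₀.conductorNorm ℤ :=
        IsNewformOf.level_eq_conductorNorm_of_exists_conductorLevel hW₀ D₀.isNewformOf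
      have := hKC W₀ N D₀ hlev.symm hmin
      linarith)
  refine ⟨D, ?_⟩
  have hdeg0 : (0 : ℝ) < (D.modularDegree : ℝ) := by exact_mod_cast D.deg_pos
  have hlog : Real.log (D.modularDegree : ℝ) ≤ K * Real.log N + (Real.log 163 + (C₀ + 1)) := by
    have : (D.modularDegree : ℝ) = (minModularDegree W N : ℝ) := by exact_mod_cast hDmin
    rw [this]
    linarith
  exact Summit.ABC.Analytic.le_exp_mul_rpow_of_log_le hdeg0 hN0 hlog

/-- Transport of a modular parametrisation datum along an equality of levels (the level is a `ℕ`-index of the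
structure; `subst`), keeping the degree. [folklore] -/
theorem exists_modularParametrizationData_of_level_eq {W : WeierstrassCurve ℚ} {N M : ℕ} [NeZero N] [NeZero M]
    (h : N = M) (D : ModularParametrizationData W N) :
    ∃ D' : ModularParametrizationData W M, D'.modularDegree = D.modularDegree := by
  subst h
  exact ⟨D, rfl⟩

/-- **CONVERSE IDIOM BRIDGE (PROVED, no named fact): abc-an's `∃ K, PolyModularDegreeRat K` ⟹ our
`ModularDegreeConjecture`** with constants `(K, log C)`. For a class-minimal datum `D` of `W` at conductor level `N`:
a global minimal model `C₁ • W` (`hasGlobalMinimalModel_rat_holds`) carries, by hypothesis, a datum `D₁` at level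
`N_{C₁•W}` with `deg D₁ ≤ C · N^K`; transported to level `N` (`N_{C₁•W} = N_W = N`, `conductorNorm_smul_rat`) it has
the newform `D.f` (`IsNewformOf.of_smul`, `IsNewformOf.unique`), so class-minimality gives `deg D ≤ deg D₁ ≤ C · N^K`
and `log deg D ≤ K log N + log C` (`C > 0` because `deg D ≥ 1`). No modularity and no Mazur–Kenku are needed in
this direction. [cite: PastenShimura2024, Conj. 3.2 (§3, p. 13)] -/
theorem modularDegreeConjecture_of_exists_polyModularDegreeRat
    (h : ∃ K : ℝ, Summit.ABC.Analytic.PolyModularDegreeRat K) : ModularDegreeConjecture := by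
  obtain ⟨K, C, hKC⟩ := h
  refine ⟨K, Real.log C, fun W _ N _ D hN hmin => ?_⟩
  -- a global minimal model and the hypothesis' datum on it, moved to level `N`
  obtain ⟨C₁, hC₁⟩ := hasGlobalMinimalModel_rat_holds W
  haveI := hC₁
  haveI : NeZero ((C₁ • W).conductorNorm ℤ) := ⟨(conductorNorm_pos_holds (C₁ • W)).ne'⟩
  obtain ⟨D₁, hD₁⟩ := hKC (C₁ • W)
  have hlev : (C₁ • W).conductorNorm ℤ = N := (conductorNorm_smul_rat W C₁).trans hN
  obtain ⟨D₂, hD₂⟩ := exists_modularParametrizationData_of_level_eq hlev D₁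
  -- same newform, so the class-minimal degree is at most `deg D₂ = deg D₁ ≤ C · N^K`
  have hf : D₂.f = D.f := (IsNewformOf.of_smul C₁ D₂.isNewformOf).unique D.isNewformOf
  have hle : D.modularDegree ≤ D₁.modularDegree := by
    have := hmin (C₁ • W) D₂ hf
    rwa [hD₂] at this
  have hdeg : (0 : ℝ) < (D.modularDegree : ℝ) := by exact_mod_cast D.deg_pos
  have hN0 : (0 : ℝ) < (N : ℝ) := by rw [← hN]; exact_mod_cast conductorNorm_pos_holds W
  have hNK : (0 : ℝ) < (N : ℝ) ^ K := Real.rpow_pos_of_pos hN0 K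
  have hcast : (((C₁ • W).conductorNorm ℤ : ℕ) : ℝ) = (N : ℝ) := by exact_mod_cast hlev
  have hbound : (D.modularDegree : ℝ) ≤ C * (N : ℝ) ^ K :=
    calc (D.modularDegree : ℝ) ≤ (D₁.modularDegree : ℝ) := by exact_mod_cast hle
      _ ≤ C * (((C₁ • W).conductorNorm ℤ : ℕ) : ℝ) ^ K := hD₁
      _ = C * (N : ℝ) ^ K := by rw [hcast]
  have hC : 0 < C := (mul_pos_iff_of_pos_right hNK).mp (hdeg.trans_le hbound)
  calc Real.log (D.modularDegree : ℝ)
      ≤ Real.log (C * (N : ℝ) ^ K) := Real.log_le_log hdeg hbound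
    _ = K * Real.log (N : ℝ) + Real.log C := by
        rw [Real.log_mul hC.ne' hNK.ne', Real.log_rpow hN0]; ring

/-- **The two cells' typings of the modular degree conjecture are EQUIVALENT modulo modularity and Mazur–Kenku**:
`ModularDegreeConjecture ↔ ∃ K, Summit.ABC.Analytic.PolyModularDegreeRat K` (forward: `hmod`, `h163`; backward:
unconditional). Pasten 2024 Conj. 3.2 typed once by each cell (abc-harv: Murty–Pasten's class-minimal `m_f` at
conductor level; abc-an: some datum of degree `≤ C · N^K` on every global minimal model) — one door, two idioms.
[cite: PastenShimura2024, Conj. 3.2 (§3, p. 13)] -/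
theorem modularDegreeConjecture_iff_exists_polyModularDegreeRat
    (hmod : nonempty_modularParametrizationData)
    (h163 : PastenShimura2024_minimalDegree_le_163_mul) :
    ModularDegreeConjecture ↔ ∃ K : ℝ, Summit.ABC.Analytic.PolyModularDegreeRat K :=
  ⟨exists_polyModularDegreeRat_of_modularDegreeConjecture hmod h163,
    modularDegreeConjecture_of_exists_polyModularDegreeRat⟩

end ModularDegree

end Summit.ABC.Harvest
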